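import Summits.QuantumFields.YangMills.Theorems.UnitScaleTiltProp7QSymCovDefect
import Summits.QuantumFields.YangMills.Theorems.UnitScaleTiltProp7QSymFlat
import Literature.MathematicalPhysics.QuantumFieldTheory.Balaban1983to89.T3PrintedRegularMinimiser
import HarnessLib

/-!
# Route `UnitScaleTilt`, crux K1 child «MinimiserStabilityRegPr» (stmt-QuantumFields-19200), stub `stub_existenceMinimalOrbit` (EX), route (α), node (AVG-SYM),
# row (46)∕M12, brick (T2) — **(46-δ-cov) AT THE T³ LETTERS: `QSym F n K h U₀` IS, UP TO `c·s·L³ε₀ · L^{K−n}‖Y‖` (k-FREE COEFFICIENT), THE GAUGE-TRANSPORTED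
# FLAT `QSym F n K h 1`** — for ANY family of SU(2) gauges `σ_c` (one per coarse bond `c`) making `U₀` `(s·ε₀·L^{−(K−n)})`-flat on the two `(K−n)`-blocks of
# `c` (★w4-19200 g2's block-centre axial gauges of (T1), `flat_centreAxial_of_regPr`, give `s = 3` at `RegPr F n K ε₀ U₀`; the instance is the companion
# `…QSymCovDefectOfRegPr`), under the window `10⁷L³ε₀ ≤ 1` of FILE 2 and `s ≤ 3`.

Cell `ym3-torus`, width seat `ym-ust-20520-w4` (gen 2).  YM₃ on T³ is a ladder rung (R3), NOT the Clay problem; nothing here is a claim about the stub, the crux, d = 4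
or the mass gap.  `--supports stmt-QuantumFields-19200 --as helper`; count-neutral; def-free.

BY NAME.  `Prop7SymAvgGL.QSym U₀ := fderiv ℂ (logChartSym U₀) 0` (p599598) read componentwise (`logChartSym_eq_logRel`: ★w1's bridge
`descendToGL_eq_fieldShift_emlIterU`; `fderiv_pi`); the flat side by ★w2-19200 g2's `Prop7QSymFlat.logChartSym_one_apply` (p600587); the estimate is the
`P`-level ★★★`differentiableAt_logRel_zero` (`…QSymCovDefect`) at `k := K − n`, `ρ := L^{−(K−n)}∕(10⁶L²)`, `s_B := s·ε₀·L^{−(K−n)}` — budget `0.8 ≤ 1`,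
`4s_B < ρ ⇐ 1.2·10⁷L²ε₀ < 1 ⇐ 10⁷L³ε₀ ≤ 1`; the product `(16M₁∕ρ²)·2s_B = 1.92·10¹¹·s·L³ε₀·L^{K−n}` (one `L^{K−n}` from `ρ⁻¹` survives: it is the gain of
`QSym` on the un-rescaled exponent `A = L^{−(K−n)}A′`, print's (44) p. 285, so the coefficient of `‖A′‖` is k-FREE).

* `logChartSym_eq_logRel` (componentwise reading of ★w1's log-chart); ★★`norm_fderiv_logRel_sub_conj_flat_le_SU2` (the `P`-level row read back in SU(2) letters, any
  `Params` — the shape (T1)'s rows live in, `c : PBond (F.P K) (K−n)`);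
* ★★★ **`norm_QSym_sub_conj_QSym_one_le`** — `‖QSym F n K h U₀ Y c − T_c⁻¹·(QSym F n K h 1 (Ad_{σ_c} Y) c)·T_c‖ ≤ 1.92·10¹¹·s·L³·ε₀·L^{K−n}·‖Y‖` with
  `T_c := (σ_c)^{(K−n)}((E c)₋)`, `(Ad_σ Y)(b) := σ(b₋)Y(b)σ(b₋)⁻¹`, `e c := bondShift … c`.

References: T. Bałaban, CMP **102** (1985) 277–309 [Balaban1985Variational] ((44)–(46) p.285); CMP **98** (1985) 17–51 [Balaban1985Averaging] ((8)–(12) p.19,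
Prop. 4 (134)–(135) p.38); CMP **109** (1987) 249–301 [Balaban1987RG1] ((0.4) p.253, (0.21) p.256).
-/

noncomputable section

open scoped BigOperators Matrix.Norms.L2Operator
open NormedSpace Metric Set

namespace Summit.QuantumFields.YangMills.Theorems.Prop7SymAvgRelativeBound

open Literature.MathematicalPhysics.QuantumFieldTheory.Balaban1983to89
open Literature.MathematicalPhysics.QuantumFieldTheory.Balaban1983to89.T3ContinuumYM3Torus
open T3PrintedRegularMinimiser (RegPr)
open T3SectALandauChart (bgUnits)
open T4Continuum
open B5Eq118OneStroke (iterBlockOf)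
open B7Prop1Explicit (expUnit val_expUnit)
open B10Eq27TorusAxialLog (gaugeActT gaugeActT_apply unitsField toUField suIncl)
open MatrixLog (mlog)
open Summit.QuantumFields.YangMills.Theorems.Prop8Chart (emlIterU coe_unitsField_toUField)
open Summit.QuantumFields.YangMills.Theorems.Prop7SymAvgGL (descendToGL logChartSym QSym descendToGL_eq_fieldShift_emlIterU)
open Summit.QuantumFields.YangMills.Theorems.Prop7QSymFlat (logChartSym_one_apply)

variable (F : T3Family) (n K : ℕ) (h : n ≤ K)

/-! ## §1 Componentwise readings of `QSym` -/

/-- **THE LOG-CHART, COMPONENTWISE, IS THE `P`-LEVEL RELATIVE CHART AT `e c := bondShift c`.** [cite: Balaban1985Variational, (44) p.285; Balaban1987RG1, (0.4) p.253] -/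
theorem logChartSym_eq_logRel (U₀ : GaugeField (F.P K) 0 (Matrix.specialUnitaryGroup (Fin 2) ℂ)) :
    logChartSym F n K h U₀ = fun A c =>
      mlog (((emlIterU (K - n) (fun b => expUnit (A b) * unitsField (toUField U₀) b)
          (T3LevelShift.bondShift (F.sitesPerDir_eq (m := F.m) (K := n) (j := 0) (m' := F.m) (K' := K) (j' := K - n) (by omega)) c) :
            (Matrix (Fin 2) (Fin 2) ℂ)ˣ) : Matrix (Fin 2) (Fin 2) ℂ) *
        (((emlIterU (K - n) (unitsField (toUField U₀))
          (T3LevelShift.bondShift (F.sitesPerDir_eq (m := F.m) (K := n) (j := 0) (m' := F.m) (K' := K) (j' := K - n) (by omega)) c))⁻¹ :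
            (Matrix (Fin 2) (Fin 2) ℂ)ˣ) : Matrix (Fin 2) (Fin 2) ℂ)) := by
  funext A c
  unfold logChartSym
  rw [descendToGL_eq_fieldShift_emlIterU, descendToGL_eq_fieldShift_emlIterU, T3LevelShift.fieldShift_apply, T3LevelShift.fieldShift_apply]
  rfl

variable {F n K}

/-- ★★ **THE COVARIANT DEFECT ROW FOR AN SU(2) BACKGROUND AND AN SU(2) GAUGE, ANY `Params`** (the `P`-level ★★★`differentiableAt_logRel_zero` with `V₀ := U₀♭`,
`û := suIncl ∘ σ`, read back in SU(2) letters): if `‖U₀^{σ}(b) − 1‖ ≤ s_B` on the finest bonds under the two `k`-blocks of `e`, `0 ≤ s_B`, `4s_B < ρ`, budget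
`6400ℓ²Lᵏ(5ρ) ≤ 1`, then for every `Y`
`‖∂_A|₀ log[Ū^{(k)}(e^{A}U₀♭)(e)·Ū^{(k)}(U₀♭)(e)⁻¹]·Y − (σ^{(k)}(e₋))⁻¹·(∂_A|₀ log Ū^{(k)}(e^{A})(e)·(Ad_σ Y))·σ^{(k)}(e₋)‖ ≤ (16M₁∕ρ²)(2s_B)‖Y‖`.
[cite: Balaban1985Variational, (44)-(46) p.285; Balaban1985Averaging, (8)-(12) p.19, Prop. 4 (134)-(135) p.38; Balaban1987RG1, (0.4) p.253] -/
theorem norm_fderiv_logRel_sub_conj_flat_le_SU2 {P : Params} {k : ℕ} (hk : k ≤ P.m + P.K) (e : PBond P k)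
    (U₀ : GaugeField P 0 (Matrix.specialUnitaryGroup (Fin 2) ℂ)) (σ : GaugeTransf P 0 (Matrix.specialUnitaryGroup (Fin 2) ℂ)) {sB ρ : ℝ}
    (hρ0 : 0 < ρ) (hbudget : 6400 * (((P.d + 2) * P.L : ℕ) : ℝ) ^ 2 * (P.L : ℝ) ^ k * (5 * ρ) ≤ 1) (hsB0 : 0 ≤ sB) (hsB : 4 * sB < ρ)
    (hflat : ∀ b : PBond P 0, (iterBlockOf k b.src = e.src ∨ iterBlockOf k b.src = e.tgt) → (iterBlockOf k b.tgt = e.src ∨ iterBlockOf k b.tgt = e.tgt) →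
      ‖((gaugeActT σ U₀ b : Matrix.specialUnitaryGroup (Fin 2) ℂ) : Matrix (Fin 2) (Fin 2) ℂ) - 1‖ ≤ sB)
    (Y : PBond P 0 → Matrix (Fin 2) (Fin 2) ℂ) :
    ‖fderiv ℂ (fun A : PBond P 0 → Matrix (Fin 2) (Fin 2) ℂ =>
          mlog (((emlIterU k (fun b => expUnit (A b) * unitsField (toUField U₀) b) e : (Matrix (Fin 2) (Fin 2) ℂ)ˣ) : Matrix (Fin 2) (Fin 2) ℂ) *
            (((emlIterU k (unitsField (toUField U₀)) e)⁻¹ : (Matrix (Fin 2) (Fin 2) ℂ)ˣ) : Matrix (Fin 2) (Fin 2) ℂ))) 0 Y -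
        (((transfUp σ k e.src)⁻¹ : Matrix.specialUnitaryGroup (Fin 2) ℂ) : Matrix (Fin 2) (Fin 2) ℂ) *
          fderiv ℂ (fun A : PBond P 0 → Matrix (Fin 2) (Fin 2) ℂ => mlog ((emlIterU k (fun b => expUnit (A b)) e : (Matrix (Fin 2) (Fin 2) ℂ)ˣ) : Matrix (Fin 2) (Fin 2) ℂ)) 0
            (fun b => ((σ b.src : Matrix.specialUnitaryGroup (Fin 2) ℂ) : Matrix (Fin 2) (Fin 2) ℂ) * Y b *
              (((σ b.src)⁻¹ : Matrix.specialUnitaryGroup (Fin 2) ℂ) : Matrix (Fin 2) (Fin 2) ℂ)) *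
          ((transfUp σ k e.src : Matrix.specialUnitaryGroup (Fin 2) ℂ) : Matrix (Fin 2) (Fin 2) ℂ)‖ ≤
      16 * (240 * (((P.d + 2) * P.L : ℕ) : ℝ) * (P.L : ℝ) ^ k * (5 * ρ)) / ρ ^ 2 * (2 * sB) * ‖Y‖ := by
  set û : GaugeTransf P 0 (Matrix (Fin 2) (Fin 2) ℂ)ˣ := fun x => Unitary.toUnits (suIncl (σ x)) with hû
  have hûn : ∀ x, ‖((û x : (Matrix (Fin 2) (Fin 2) ℂ)ˣ) : Matrix (Fin 2) (Fin 2) ℂ)‖ ≤ 1 := fun x => (norm_coe_toUnits_suIncl (σ x)).le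
  have hûn' : ∀ x, ‖(((û x)⁻¹ : (Matrix (Fin 2) (Fin 2) ℂ)ˣ) : Matrix (Fin 2) (Fin 2) ℂ)‖ ≤ 1 := fun x => (norm_coe_toUnits_suIncl_inv (σ x)).le
  have hlift : ∀ (j : ℕ) (z : Site P j), transfUp û j z = Unitary.toUnits (suIncl (transfUp σ j z)) := by
    intro j
    induction j with
    | zero => intro z; rfl
    | succ j ih => intro z; exact ih (emb z)
  have hT : ((transfUp û k e.src : (Matrix (Fin 2) (Fin 2) ℂ)ˣ) : Matrix (Fin 2) (Fin 2) ℂ) =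
      ((transfUp σ k e.src : Matrix.specialUnitaryGroup (Fin 2) ℂ) : Matrix (Fin 2) (Fin 2) ℂ) := by
    rw [hlift, coe_toUnits_suIncl]
  have hT' : (((transfUp û k e.src)⁻¹ : (Matrix (Fin 2) (Fin 2) ℂ)ˣ) : Matrix (Fin 2) (Fin 2) ℂ) =
      (((transfUp σ k e.src)⁻¹ : Matrix.specialUnitaryGroup (Fin 2) ℂ) : Matrix (Fin 2) (Fin 2) ℂ) := by
    rw [hlift, ← map_inv, ← map_inv]; rfl
  have hAd : (fun b : PBond P 0 => ((û b.src : (Matrix (Fin 2) (Fin 2) ℂ)ˣ) : Matrix (Fin 2) (Fin 2) ℂ) * Y b *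
      (((û b.src)⁻¹ : (Matrix (Fin 2) (Fin 2) ℂ)ˣ) : Matrix (Fin 2) (Fin 2) ℂ)) =
      fun b => ((σ b.src : Matrix.specialUnitaryGroup (Fin 2) ℂ) : Matrix (Fin 2) (Fin 2) ℂ) * Y b *
        (((σ b.src)⁻¹ : Matrix.specialUnitaryGroup (Fin 2) ℂ) : Matrix (Fin 2) (Fin 2) ℂ) := by
    funext b
    rw [hû]
    dsimp only
    rw [← map_inv, ← map_inv]
    rfl
  have hV : ∀ b : PBond P 0, (iterBlockOf k b.src = e.src ∨ iterBlockOf k b.src = e.tgt) → (iterBlockOf k b.tgt = e.src ∨ iterBlockOf k b.tgt = e.tgt) →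
      ‖((gaugeActT û (unitsField (toUField U₀)) b : (Matrix (Fin 2) (Fin 2) ℂ)ˣ) : Matrix (Fin 2) (Fin 2) ℂ) - 1‖ ≤ sB := by
    intro b hbs hbt
    rw [hû, ← unitsField_toUField_gaugeActT, coe_unitsField_toUField]
    exact hflat b hbs hbt
  obtain ⟨_, hrow⟩ := differentiableAt_logRel_zero hk e (unitsField (toUField U₀)) û hûn hûn' hρ0 hbudget hsB0 hsB hV
  have hP := hrow Y
  rw [hT, hT', hAd] at hP
  exact hP

/-- ★★★ **(46-δ-cov) AT THE T³ LETTERS.**  Member `(F, n, K)`, `n ≤ K`; background `U₀`; `0 < ε₀`, `10⁷L³ε₀ ≤ 1`; a family of SU(2) gauges `σ_c` with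
`‖U₀^{σ_c}(b) − 1‖ ≤ s·ε₀·L^{−(K−n)}` on the finest bonds `b` under the two `(K−n)`-blocks of `e c` (`0 ≤ s ≤ 3`).  Then for every `Y` and `c`:
`‖QSym F n K h U₀ Y c − T_c⁻¹·(QSym F n K h 1 (Ad_{σ_c} Y) c)·T_c‖ ≤ 1.92·10¹¹·s·L³·ε₀·L^{K−n}·‖Y‖`, `T_c := σ_c^{(K−n)}((E c)₋)`.
[cite: Balaban1985Variational, (44)-(46) p.285; Balaban1985Averaging, (8)-(12) p.19, Prop. 4 (134)-(135) p.38; Balaban1987RG1, (0.4) p.253] -/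
theorem norm_QSym_sub_conj_QSym_one_le {ε₀ : ℝ} (hε₀ : 0 < ε₀) (hε : 10 ^ 7 * (F.L : ℝ) ^ 3 * ε₀ ≤ 1)
    (U₀ : GaugeField (F.P K) 0 (Matrix.specialUnitaryGroup (Fin 2) ℂ))
    (σ : PBond (F.P n) 0 → GaugeTransf (F.P K) 0 (Matrix.specialUnitaryGroup (Fin 2) ℂ)) {s : ℝ} (hs0 : 0 ≤ s) (hs3 : s ≤ 3)
    (hflat : ∀ (c : PBond (F.P n) 0) (b : PBond (F.P K) 0),
      (iterBlockOf (K - n) b.src = (T3LevelShift.bondShift (F.sitesPerDir_eq (m := F.m) (K := n) (j := 0) (m' := F.m) (K' := K) (j' := K - n) (by omega)) c).src ∨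
        iterBlockOf (K - n) b.src = (T3LevelShift.bondShift (F.sitesPerDir_eq (m := F.m) (K := n) (j := 0) (m' := F.m) (K' := K) (j' := K - n) (by omega)) c).tgt) →
      (iterBlockOf (K - n) b.tgt = (T3LevelShift.bondShift (F.sitesPerDir_eq (m := F.m) (K := n) (j := 0) (m' := F.m) (K' := K) (j' := K - n) (by omega)) c).src ∨
        iterBlockOf (K - n) b.tgt = (T3LevelShift.bondShift (F.sitesPerDir_eq (m := F.m) (K := n) (j := 0) (m' := F.m) (K' := K) (j' := K - n) (by omega)) c).tgt) →
      ‖((gaugeActT (σ c) U₀ b : Matrix.specialUnitaryGroup (Fin 2) ℂ) : Matrix (Fin 2) (Fin 2) ℂ) - 1‖ ≤ s * ε₀ * ((F.L : ℝ) ^ (K - n))⁻¹)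
    (Y : PBond (F.P K) 0 → Matrix (Fin 2) (Fin 2) ℂ) (c : PBond (F.P n) 0) :
    ‖QSym F n K h U₀ Y c -
        (((transfUp (σ c) (K - n)
            (T3LevelShift.bondShift (F.sitesPerDir_eq (m := F.m) (K := n) (j := 0) (m' := F.m) (K' := K) (j' := K - n) (by omega)) c).src)⁻¹ :
              Matrix.specialUnitaryGroup (Fin 2) ℂ) : Matrix (Fin 2) (Fin 2) ℂ) *
          QSym F n K h 1 (fun b => ((σ c b.src : Matrix.specialUnitaryGroup (Fin 2) ℂ) : Matrix (Fin 2) (Fin 2) ℂ) * Y b *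
            (((σ c b.src)⁻¹ : Matrix.specialUnitaryGroup (Fin 2) ℂ) : Matrix (Fin 2) (Fin 2) ℂ)) c *
          ((transfUp (σ c) (K - n)
            (T3LevelShift.bondShift (F.sitesPerDir_eq (m := F.m) (K := n) (j := 0) (m' := F.m) (K' := K) (j' := K - n) (by omega)) c).src :
              Matrix.specialUnitaryGroup (Fin 2) ℂ) : Matrix (Fin 2) (Fin 2) ℂ)‖ ≤
      192000 * 10 ^ 6 * s * (F.L : ℝ) ^ 3 * ε₀ * (F.L : ℝ) ^ (K - n) * ‖Y‖ := by
  -- letters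
  have hd : (F.P K).d = 3 := T3Family.P_d F K
  have hLL : ((F.P K).L : ℝ) = F.L := rfl
  have hL3 : 3 ≤ F.L := by obtain ⟨a, ha⟩ := F.hL.1; have := F.hL.2; omega
  have hL3r : (3 : ℝ) ≤ F.L := by exact_mod_cast hL3
  have hL0 : (0 : ℝ) < F.L := by linarith
  have hk : K - n ≤ (F.P K).m + (F.P K).K := by
    show K - n ≤ F.m + K; omega
  set E := T3LevelShift.bondShift (F.sitesPerDir_eq (m := F.m) (K := n) (j := 0) (m' := F.m) (K' := K) (j' := K - n) (by omega)) with hE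
  set X : ℝ := (F.L : ℝ) ^ (K - n) with hX
  have hX0 : 0 < X := by positivity
  set ρ : ℝ := X⁻¹ / (10 ^ 6 * (F.L : ℝ) ^ 2) with hρ
  have hρ0 : 0 < ρ := by positivity
  set sB : ℝ := s * ε₀ * X⁻¹ with hsB
  have hsB0 : 0 ≤ sB := by positivity
  -- the budget `6400ℓ²L^{K−n}(5ρ) = 0.8 ≤ 1` and `4 s_B < ρ`
  have hbudget : 6400 * (((3 + 2) * F.L : ℕ) : ℝ) ^ 2 * X * (5 * ρ) ≤ 1 := by
    have hval : 6400 * (((3 + 2) * F.L : ℕ) : ℝ) ^ 2 * X * (5 * ρ) = 4 / 5 := by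
      rw [hρ]; push_cast
      field_simp
      ring
    rw [hval]; norm_num
  have h4sB : 4 * sB < ρ := by
    have hXi : 0 < X⁻¹ := by positivity
    have hA : s * ε₀ * (F.L : ℝ) ^ 2 ≤ 3 * ε₀ * (F.L : ℝ) ^ 2 := by gcongr
    have hB : 3 * (ε₀ * (F.L : ℝ) ^ 2) ≤ ε₀ * (F.L : ℝ) ^ 3 := by
      have h0 : 0 ≤ ε₀ * (F.L : ℝ) ^ 2 * ((F.L : ℝ) - 3) := mul_nonneg (by positivity) (sub_nonneg.2 hL3r)
      nlinarith [h0]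
    have hmain : 4 * s * ε₀ * (10 ^ 6 * (F.L : ℝ) ^ 2) < 1 := by nlinarith [hA, hB, hε, hε₀]
    rw [hsB, hρ, lt_div_iff₀ (by positivity)]
    calc 4 * (s * ε₀ * X⁻¹) * (10 ^ 6 * (F.L : ℝ) ^ 2) = X⁻¹ * (4 * s * ε₀ * (10 ^ 6 * (F.L : ℝ) ^ 2)) := by ring
      _ < X⁻¹ * 1 := mul_lt_mul_of_pos_left hmain hXi
      _ = X⁻¹ := mul_one _
  -- the units-valued gauge `û := suIncl ∘ σ_c`, its norms, its lift
  set û : GaugeTransf (F.P K) 0 (Matrix (Fin 2) (Fin 2) ℂ)ˣ := fun x => Unitary.toUnits (suIncl (σ c x)) with hû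
  have hûn : ∀ x, ‖((û x : (Matrix (Fin 2) (Fin 2) ℂ)ˣ) : Matrix (Fin 2) (Fin 2) ℂ)‖ ≤ 1 := fun x => (norm_coe_toUnits_suIncl (σ c x)).le
  have hûn' : ∀ x, ‖(((û x)⁻¹ : (Matrix (Fin 2) (Fin 2) ℂ)ˣ) : Matrix (Fin 2) (Fin 2) ℂ)‖ ≤ 1 := fun x => (norm_coe_toUnits_suIncl_inv (σ c x)).le
  have hlift : ∀ (k : ℕ) (z : Site (F.P K) k), transfUp û k z = Unitary.toUnits (suIncl (transfUp (σ c) k z)) := by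
    intro k
    induction k with
    | zero => intro z; rfl
    | succ k ih => intro z; exact ih (emb z)
  have hT : ((transfUp û (K - n) (E c).src : (Matrix (Fin 2) (Fin 2) ℂ)ˣ) : Matrix (Fin 2) (Fin 2) ℂ) =
      ((transfUp (σ c) (K - n) (E c).src : Matrix.specialUnitaryGroup (Fin 2) ℂ) : Matrix (Fin 2) (Fin 2) ℂ) := by
    rw [hlift, coe_toUnits_suIncl]
  have hT' : (((transfUp û (K - n) (E c).src)⁻¹ : (Matrix (Fin 2) (Fin 2) ℂ)ˣ) : Matrix (Fin 2) (Fin 2) ℂ) =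
      (((transfUp (σ c) (K - n) (E c).src)⁻¹ : Matrix.specialUnitaryGroup (Fin 2) ℂ) : Matrix (Fin 2) (Fin 2) ℂ) := by
    rw [hlift, ← map_inv, ← map_inv]; rfl
  have hAd : (fun b : PBond (F.P K) 0 => ((û b.src : (Matrix (Fin 2) (Fin 2) ℂ)ˣ) : Matrix (Fin 2) (Fin 2) ℂ) * Y b *
      (((û b.src)⁻¹ : (Matrix (Fin 2) (Fin 2) ℂ)ˣ) : Matrix (Fin 2) (Fin 2) ℂ)) =
      fun b => ((σ c b.src : Matrix.specialUnitaryGroup (Fin 2) ℂ) : Matrix (Fin 2) (Fin 2) ℂ) * Y b *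
        (((σ c b.src)⁻¹ : Matrix.specialUnitaryGroup (Fin 2) ℂ) : Matrix (Fin 2) (Fin 2) ℂ) := by
    funext b
    rw [hû]
    dsimp only
    rw [← map_inv, ← map_inv]
    rfl
  -- the flatness hypothesis in the units letters
  have hV : ∀ b : PBond (F.P K) 0, (iterBlockOf (K - n) b.src = (E c).src ∨ iterBlockOf (K - n) b.src = (E c).tgt) →
      (iterBlockOf (K - n) b.tgt = (E c).src ∨ iterBlockOf (K - n) b.tgt = (E c).tgt) →
      ‖((gaugeActT û (unitsField (toUField U₀)) b : (Matrix (Fin 2) (Fin 2) ℂ)ˣ) : Matrix (Fin 2) (Fin 2) ℂ) - 1‖ ≤ sB := by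
    intro b hbs hbt
    rw [hû, ← unitsField_toUField_gaugeActT, coe_unitsField_toUField]
    exact hflat c b hbs hbt
  -- the P-level covariant defect row at `k := K − n`, `e := e c`
  obtain ⟨_, hrow⟩ := differentiableAt_logRel_zero hk (E c) (unitsField (toUField U₀)) û hûn hûn' hρ0 (by rw [hd, hLL, ← hX]; exact hbudget)
    hsB0 h4sB hV
  have hP := hrow Y
  -- read `QSym U₀ Y c` and `QSym 1 (Ad Y) c` as the `P`-level derivatives
  have hcompU : ∀ c' : PBond (F.P n) 0, DifferentiableAt ℂ (fun A : PBond (F.P K) 0 → Matrix (Fin 2) (Fin 2) ℂ =>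
      mlog (((emlIterU (K - n) (fun b => expUnit (A b) * unitsField (toUField U₀) b) (E c') : (Matrix (Fin 2) (Fin 2) ℂ)ˣ) : Matrix (Fin 2) (Fin 2) ℂ) *
        (((emlIterU (K - n) (unitsField (toUField U₀)) (E c'))⁻¹ : (Matrix (Fin 2) (Fin 2) ℂ)ˣ) : Matrix (Fin 2) (Fin 2) ℂ))) 0 := by
    intro c'
    -- the same P-level theorem at `c'` with the gauge `σ_{c'}`
    set û' : GaugeTransf (F.P K) 0 (Matrix (Fin 2) (Fin 2) ℂ)ˣ := fun x => Unitary.toUnits (suIncl (σ c' x)) with hû'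
    have hV' : ∀ b : PBond (F.P K) 0, (iterBlockOf (K - n) b.src = (E c').src ∨ iterBlockOf (K - n) b.src = (E c').tgt) →
        (iterBlockOf (K - n) b.tgt = (E c').src ∨ iterBlockOf (K - n) b.tgt = (E c').tgt) →
        ‖((gaugeActT û' (unitsField (toUField U₀)) b : (Matrix (Fin 2) (Fin 2) ℂ)ˣ) : Matrix (Fin 2) (Fin 2) ℂ) - 1‖ ≤ sB := by
      intro b hbs hbt
      rw [hû', ← unitsField_toUField_gaugeActT, coe_unitsField_toUField]
      exact hflat c' b hbs hbt
    exact (differentiableAt_logRel_zero hk (E c') (unitsField (toUField U₀)) û' (fun x => (norm_coe_toUnits_suIncl (σ c' x)).le)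
      (fun x => (norm_coe_toUnits_suIncl_inv (σ c' x)).le) hρ0 (by rw [hd, hLL, ← hX]; exact hbudget) hsB0 h4sB hV').1
  have hderU : HasFDerivAt (fun (A : PBond (F.P K) 0 → Matrix (Fin 2) (Fin 2) ℂ) (c' : PBond (F.P n) 0) =>
      mlog (((emlIterU (K - n) (fun b => expUnit (A b) * unitsField (toUField U₀) b) (E c') : (Matrix (Fin 2) (Fin 2) ℂ)ˣ) : Matrix (Fin 2) (Fin 2) ℂ) *
        (((emlIterU (K - n) (unitsField (toUField U₀)) (E c'))⁻¹ : (Matrix (Fin 2) (Fin 2) ℂ)ˣ) : Matrix (Fin 2) (Fin 2) ℂ)))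
      (ContinuousLinearMap.pi fun c' : PBond (F.P n) 0 => fderiv ℂ (fun A : PBond (F.P K) 0 → Matrix (Fin 2) (Fin 2) ℂ =>
        mlog (((emlIterU (K - n) (fun b => expUnit (A b) * unitsField (toUField U₀) b) (E c') : (Matrix (Fin 2) (Fin 2) ℂ)ˣ) : Matrix (Fin 2) (Fin 2) ℂ) *
          (((emlIterU (K - n) (unitsField (toUField U₀)) (E c'))⁻¹ : (Matrix (Fin 2) (Fin 2) ℂ)ˣ) : Matrix (Fin 2) (Fin 2) ℂ))) 0) 0 :=
    hasFDerivAt_pi.2 fun c' => (hcompU c').hasFDerivAt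
  have hfdU : fderiv ℂ (logChartSym F n K h U₀) 0 =
      ContinuousLinearMap.pi fun c' : PBond (F.P n) 0 => fderiv ℂ (fun A : PBond (F.P K) 0 → Matrix (Fin 2) (Fin 2) ℂ =>
        mlog (((emlIterU (K - n) (fun b => expUnit (A b) * unitsField (toUField U₀) b) (E c') : (Matrix (Fin 2) (Fin 2) ℂ)ˣ) : Matrix (Fin 2) (Fin 2) ℂ) *
          (((emlIterU (K - n) (unitsField (toUField U₀)) (E c'))⁻¹ : (Matrix (Fin 2) (Fin 2) ℂ)ˣ) : Matrix (Fin 2) (Fin 2) ℂ))) 0 := by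
    rw [logChartSym_eq_logRel F n K h U₀]
    exact hderU.fderiv
  have hQU : QSym F n K h U₀ Y c = fderiv ℂ (fun A : PBond (F.P K) 0 → Matrix (Fin 2) (Fin 2) ℂ =>
      mlog (((emlIterU (K - n) (fun b => expUnit (A b) * unitsField (toUField U₀) b) (E c) : (Matrix (Fin 2) (Fin 2) ℂ)ˣ) : Matrix (Fin 2) (Fin 2) ℂ) *
        (((emlIterU (K - n) (unitsField (toUField U₀)) (E c))⁻¹ : (Matrix (Fin 2) (Fin 2) ℂ)ˣ) : Matrix (Fin 2) (Fin 2) ℂ))) 0 Y := by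
    unfold QSym
    rw [hfdU]
    rfl
  have hcomp1 : ∀ c' : PBond (F.P n) 0, DifferentiableAt ℂ (fun A : PBond (F.P K) 0 → Matrix (Fin 2) (Fin 2) ℂ =>
      mlog ((emlIterU (K - n) (fun b => expUnit (A b)) (E c') : (Matrix (Fin 2) (Fin 2) ℂ)ˣ) : Matrix (Fin 2) (Fin 2) ℂ)) 0 :=
    fun c' => differentiableAt_flatChart_zero hk (E c')
  have hfun1 : logChartSym F n K h 1 = fun A c' =>
      mlog ((emlIterU (K - n) (fun b => expUnit (A b)) (E c') : (Matrix (Fin 2) (Fin 2) ℂ)ˣ) : Matrix (Fin 2) (Fin 2) ℂ) := by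
    funext A c'; exact logChartSym_one_apply F n K h A c'
  have hder1 : HasFDerivAt (fun (A : PBond (F.P K) 0 → Matrix (Fin 2) (Fin 2) ℂ) (c' : PBond (F.P n) 0) =>
      mlog ((emlIterU (K - n) (fun b => expUnit (A b)) (E c') : (Matrix (Fin 2) (Fin 2) ℂ)ˣ) : Matrix (Fin 2) (Fin 2) ℂ))
      (ContinuousLinearMap.pi fun c' : PBond (F.P n) 0 => fderiv ℂ (fun A : PBond (F.P K) 0 → Matrix (Fin 2) (Fin 2) ℂ =>
        mlog ((emlIterU (K - n) (fun b => expUnit (A b)) (E c') : (Matrix (Fin 2) (Fin 2) ℂ)ˣ) : Matrix (Fin 2) (Fin 2) ℂ)) 0) 0 :=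
    hasFDerivAt_pi.2 fun c' => (hcomp1 c').hasFDerivAt
  have hfd1 : fderiv ℂ (logChartSym F n K h 1) 0 =
      ContinuousLinearMap.pi fun c' : PBond (F.P n) 0 => fderiv ℂ (fun A : PBond (F.P K) 0 → Matrix (Fin 2) (Fin 2) ℂ =>
        mlog ((emlIterU (K - n) (fun b => expUnit (A b)) (E c') : (Matrix (Fin 2) (Fin 2) ℂ)ˣ) : Matrix (Fin 2) (Fin 2) ℂ)) 0 := by
    rw [hfun1]
    exact hder1.fderiv
  have hQ1 : ∀ Z : PBond (F.P K) 0 → Matrix (Fin 2) (Fin 2) ℂ, QSym F n K h 1 Z c = fderiv ℂ (fun A : PBond (F.P K) 0 → Matrix (Fin 2) (Fin 2) ℂ =>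
      mlog ((emlIterU (K - n) (fun b => expUnit (A b)) (E c) : (Matrix (Fin 2) (Fin 2) ℂ)ˣ) : Matrix (Fin 2) (Fin 2) ℂ)) 0 Z := by
    intro Z
    unfold QSym
    rw [hfd1]
    rfl
  rw [hQU, hQ1, ← hT, ← hT', ← hAd]
  refine hP.trans (le_of_eq ?_)
  rw [hd]; push_cast
  rw [hLL, ← hX, hsB, hρ]
  field_simp
  ring

end Summit.QuantumFields.YangMills.Theorems.Prop7SymAvgRelativeBound

end
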